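import Summits.ABC.IUTFork.Repair.RHHeightClassKLine
import HarnessLib

/-!
# R-H row 8 «heightclass» — CERT-HEX-L0-v1 rows k = 1..10 DISCHARGED BY NAME (the λ_k K-line, `p = 7`, `ε(k) = 30/gcd(30,k)`, `m_q = k·ε`)
Companion of `RHHeightClassKLine` (p476616; seat abc-iut-rh-typ-8 gen 4; rung LADDER-ABC:A2.RESCUE.H; table abc-iut-rh2-q3-num CERT-HEX-L0-v1.tsv
b5a780be0dc3ac17 / Q3-HEX-v1.1.tsv 9c944397edd7d015). For each k: the untied `r♯` rows (`strictMinPow_of_window` one-liners), the integer NEG/POS rows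
(`norm_num`), and «λ_k ∈ Σ₈ at prime l ≥ 11 ⟺ l ≥ l₀⁸(k)» from `hexTop_of_two_rows` / `not_hexTop_between` (or `hexTop_of_linear_nonneg` when l₀ = 11).
«∈ Σ₈ at l» := the row-8 TOP CELL `(l⋆²−1)·kε ≤ l⋆(e_w − r♯) + 1 − r♯` at the untied `r♯(7, e_w = l·ε)` (all labels follow: `band_le_of_top`; this IS the
typed `HBand` clause at such a place: `exists_certVal_cell_iff`, `bandCell_int_iff`). PROOF-ONLY (0 definitions). TAKES NO SIDE on [IUTchIII] Cor. 3.12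
or on any author; nothing here asserts abc; `HBand`/`StrictMinPow` are row 8's CANDIDATE vocabulary (hypotheses); computed-by-q3-num = proved-here for
these rows only. [claim: Mochizuki2012, status: disputed] for the candidate's reading; the arithmetic is [folklore].
-/

namespace Summit.ABC.IUTFork.Repair.RHHeightClass.KLine

open Summit.ABC.IUTFork.Repair.RHHeightClass Summit.ABC.IUTFork.Repair.RH.Q3LTailBand

/-- **MONOTONE CORE**: `Ψ(n) = (n+1)(μεn + q) + (ε+1)` with `ε, μ ≥ 0`, `0 ≤ b ≤ c` and linear part `μεb + q ≥ 0` ⟹ `0 ≤ Ψ(c)`. [folklore] -/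
theorem upset_of_linear_nonneg {μ q ε b c : ℤ} (hε : 0 ≤ ε) (hμ : 0 ≤ μ) (hb : 0 ≤ b) (hbc : b ≤ c) (hA : 0 ≤ μ * ε * b + q) :
    0 ≤ (c + 1) * (μ * ε * c + q) + (ε + 1) := by
  have h1 : μ * ε * b + q ≤ μ * ε * c + q := by nlinarith [mul_nonneg hμ hε]
  have h2 : 0 ≤ (c + 1) * (μ * ε * c + q) := mul_nonneg (by linarith) (by linarith)
  linarith

/-- **MONOTONE LEMMA in slice currency** (for the CERT rows «POS at l = 11»): at exponent `τ` with `2τ + 2 − k ≥ 0`, if the linear part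
`(2τ+2−k)·ε·b + ((τ−1+k)·ε − p^τ)` is `≥ 0` at `l⋆ = b`, then the top cell holds at every `l⋆ = c ≥ b` at every `r ≤ p^τ − τ·e_c` (e.g. the untied `r♯`). [folklore] -/
theorem hexTop_of_linear_nonneg {p : ℕ} {ε k : ℤ} {b : ℕ} (hε : 1 ≤ ε) (τ : ℕ) (hμ : 0 ≤ 2 * (τ : ℤ) + 2 - k)
    (hA : 0 ≤ (2 * (τ : ℤ) + 2 - k) * ε * b + (((τ : ℤ) - 1 + k) * ε - (p : ℤ) ^ τ))
    {c : ℕ} (hbc : b ≤ c) {rc : ℤ} (hrc : rc ≤ (p : ℤ) ^ τ - τ * ((2 * c + 1 : ℤ) * ε)) :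
    (((c : ℤ)) ^ 2 - 1) * (k * ε) ≤ (c : ℤ) * ((2 * c + 1 : ℤ) * ε - rc) + (1 - rc) := by
  have key := topSlack_eq (c : ℤ) ((p : ℤ) ^ τ) (τ : ℤ) k ε
  have h := upset_of_linear_nonneg (μ := 2 * (τ : ℤ) + 2 - k) (q := ((τ : ℤ) - 1 + k) * ε - (p : ℤ) ^ τ) (b := (b : ℤ)) (c := (c : ℤ))
    (by linarith) hμ (by positivity) (by exact_mod_cast hbc) hA
  have hc0 : (0 : ℤ) ≤ c := by positivity
  nlinarith

/-- **`λ_1` K-line (`p = 7`, `ε = 30`, `m_q = 30`; CERT-HEX-L0-v1 row `k = 1`: `l₀ = 11`, `e_w = 330`, `r♯ = -647`, `t⋆ = 3`): IN Σ₈ for EVERY prime `l ≥ 11`** — at exponent `t⋆ = 3` the linear part has slope `(2t⋆+2−k)·ε = 210 ≥ 0` and value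
`797 ≥ 0` at `l⋆ = 5`, so the top cell holds at `7^3 − 3·e_w ≥ r♯` for every `l⋆ ≥ 5` (`hexTop_of_linear_nonneg`), hence at the untied `r♯(7, 30l)`. [folklore] -/
theorem lambda1_in_sigma8_of_ge_11 {l : ℕ} (hl : l.Prime) (h11 : 11 ≤ l) :
    (∃ r : ℤ, StrictMinPow 7 (l * 30) r) ∧
      ∀ r : ℤ, StrictMinPow 7 (l * 30) r → ((((l / 2 : ℕ) : ℤ)) ^ 2 - 1) * ((1 : ℤ) * 30) ≤ (((l / 2 : ℕ) : ℤ)) * ((((l * 30 : ℕ) : ℤ)) - (r)) + (1 - (r)) := by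
  have hodd : l % 2 = 1 := Nat.odd_iff.1 (hl.odd_of_ne_two (by omega))
  refine ⟨exists_strictMinPow_kline (p := 7) (by norm_num) hl (by omega) 30, fun r hr => ?_⟩
  have hc : (5 : ℕ) ≤ l / 2 := by omega
  have hcast : ((l * 30 : ℕ) : ℤ) = (2 * ((l / 2 : ℕ) : ℤ) + 1) * 30 := by omega
  have hle := strictMinPow_le_pow_sub hr 3
  rw [hcast] at hle ⊢
  exact hexTop_of_linear_nonneg (p := 7) (ε := 30) (k := 1) (b := 5) (by norm_num) 3 (by norm_num) (by norm_num) hc hle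

/-- **`λ_2` K-line (`p = 7`, `ε = 15`, `m_q = 30`; CERT-HEX-L0-v1 row `k = 2`: `l₀ = 11`, `e_w = 165`, `r♯ = -281`, `t⋆ = 2`): IN Σ₈ for EVERY prime `l ≥ 11`** — at exponent `t⋆ = 2` the linear part has slope `(2t⋆+2−k)·ε = 60 ≥ 0` and value
`296 ≥ 0` at `l⋆ = 5`, so the top cell holds at `7^2 − 2·e_w ≥ r♯` for every `l⋆ ≥ 5` (`hexTop_of_linear_nonneg`), hence at the untied `r♯(7, 15l)`. [folklore] -/
theorem lambda2_in_sigma8_of_ge_11 {l : ℕ} (hl : l.Prime) (h11 : 11 ≤ l) :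
    (∃ r : ℤ, StrictMinPow 7 (l * 15) r) ∧
      ∀ r : ℤ, StrictMinPow 7 (l * 15) r → ((((l / 2 : ℕ) : ℤ)) ^ 2 - 1) * ((2 : ℤ) * 15) ≤ (((l / 2 : ℕ) : ℤ)) * ((((l * 15 : ℕ) : ℤ)) - (r)) + (1 - (r)) := by
  have hodd : l % 2 = 1 := Nat.odd_iff.1 (hl.odd_of_ne_two (by omega))
  refine ⟨exists_strictMinPow_kline (p := 7) (by norm_num) hl (by omega) 15, fun r hr => ?_⟩
  have hc : (5 : ℕ) ≤ l / 2 := by omega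
  have hcast : ((l * 15 : ℕ) : ℤ) = (2 * ((l / 2 : ℕ) : ℤ) + 1) * 15 := by omega
  have hle := strictMinPow_le_pow_sub hr 2
  rw [hcast] at hle ⊢
  exact hexTop_of_linear_nonneg (p := 7) (ε := 15) (k := 2) (b := 5) (by norm_num) 2 (by norm_num) (by norm_num) hc hle

/-- **`λ_3` K-line (`p = 7`, `ε = 10`, `m_q = 30`; CERT-HEX-L0-v1 row `k = 3`: `l₀ = 11`, `e_w = 110`, `r♯ = -171`, `t⋆ = 2`): IN Σ₈ for EVERY prime `l ≥ 11`** — at exponent `t⋆ = 2` the linear part has slope `(2t⋆+2−k)·ε = 30 ≥ 0` and value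
`141 ≥ 0` at `l⋆ = 5`, so the top cell holds at `7^2 − 2·e_w ≥ r♯` for every `l⋆ ≥ 5` (`hexTop_of_linear_nonneg`), hence at the untied `r♯(7, 10l)`. [folklore] -/
theorem lambda3_in_sigma8_of_ge_11 {l : ℕ} (hl : l.Prime) (h11 : 11 ≤ l) :
    (∃ r : ℤ, StrictMinPow 7 (l * 10) r) ∧
      ∀ r : ℤ, StrictMinPow 7 (l * 10) r → ((((l / 2 : ℕ) : ℤ)) ^ 2 - 1) * ((3 : ℤ) * 10) ≤ (((l / 2 : ℕ) : ℤ)) * ((((l * 10 : ℕ) : ℤ)) - (r)) + (1 - (r)) := by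
  have hodd : l % 2 = 1 := Nat.odd_iff.1 (hl.odd_of_ne_two (by omega))
  refine ⟨exists_strictMinPow_kline (p := 7) (by norm_num) hl (by omega) 10, fun r hr => ?_⟩
  have hc : (5 : ℕ) ≤ l / 2 := by omega
  have hcast : ((l * 10 : ℕ) : ℤ) = (2 * ((l / 2 : ℕ) : ℤ) + 1) * 10 := by omega
  have hle := strictMinPow_le_pow_sub hr 2
  rw [hcast] at hle ⊢
  exact hexTop_of_linear_nonneg (p := 7) (ε := 10) (k := 3) (b := 5) (by norm_num) 2 (by norm_num) (by norm_num) hc hle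

/-- **`λ_4` K-line (`p = 7`, `ε = 15`, `m_q = 60`; CERT-HEX-L0-v1 row `k = 4`: `l₀ = 11`, `e_w = 165`, `r♯ = -281`, `t⋆ = 2`): IN Σ₈ for EVERY prime `l ≥ 11`** — at exponent `t⋆ = 2` the linear part has slope `(2t⋆+2−k)·ε = 30 ≥ 0` and value
`176 ≥ 0` at `l⋆ = 5`, so the top cell holds at `7^2 − 2·e_w ≥ r♯` for every `l⋆ ≥ 5` (`hexTop_of_linear_nonneg`), hence at the untied `r♯(7, 15l)`. [folklore] -/
theorem lambda4_in_sigma8_of_ge_11 {l : ℕ} (hl : l.Prime) (h11 : 11 ≤ l) :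
    (∃ r : ℤ, StrictMinPow 7 (l * 15) r) ∧
      ∀ r : ℤ, StrictMinPow 7 (l * 15) r → ((((l / 2 : ℕ) : ℤ)) ^ 2 - 1) * ((4 : ℤ) * 15) ≤ (((l / 2 : ℕ) : ℤ)) * ((((l * 15 : ℕ) : ℤ)) - (r)) + (1 - (r)) := by
  have hodd : l % 2 = 1 := Nat.odd_iff.1 (hl.odd_of_ne_two (by omega))
  refine ⟨exists_strictMinPow_kline (p := 7) (by norm_num) hl (by omega) 15, fun r hr => ?_⟩
  have hc : (5 : ℕ) ≤ l / 2 := by omega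
  have hcast : ((l * 15 : ℕ) : ℤ) = (2 * ((l / 2 : ℕ) : ℤ) + 1) * 15 := by omega
  have hle := strictMinPow_le_pow_sub hr 2
  rw [hcast] at hle ⊢
  exact hexTop_of_linear_nonneg (p := 7) (ε := 15) (k := 4) (b := 5) (by norm_num) 2 (by norm_num) (by norm_num) hc hle

/-- **`λ_5` K-line (`p = 7`, `ε = 6`, `m_q = 30`; CERT-HEX-L0-v1 row `k = 5`: `l₀ = 11`, `e_w = 66`, `r♯ = -83`, `t⋆ = 2`): IN Σ₈ for EVERY prime `l ≥ 11`** — at exponent `t⋆ = 2` the linear part has slope `(2t⋆+2−k)·ε = 6 ≥ 0` and value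
`17 ≥ 0` at `l⋆ = 5`, so the top cell holds at `7^2 − 2·e_w ≥ r♯` for every `l⋆ ≥ 5` (`hexTop_of_linear_nonneg`), hence at the untied `r♯(7, 6l)`. [folklore] -/
theorem lambda5_in_sigma8_of_ge_11 {l : ℕ} (hl : l.Prime) (h11 : 11 ≤ l) :
    (∃ r : ℤ, StrictMinPow 7 (l * 6) r) ∧
      ∀ r : ℤ, StrictMinPow 7 (l * 6) r → ((((l / 2 : ℕ) : ℤ)) ^ 2 - 1) * ((5 : ℤ) * 6) ≤ (((l / 2 : ℕ) : ℤ)) * ((((l * 6 : ℕ) : ℤ)) - (r)) + (1 - (r)) := by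
  have hodd : l % 2 = 1 := Nat.odd_iff.1 (hl.odd_of_ne_two (by omega))
  refine ⟨exists_strictMinPow_kline (p := 7) (by norm_num) hl (by omega) 6, fun r hr => ?_⟩
  have hc : (5 : ℕ) ≤ l / 2 := by omega
  have hcast : ((l * 6 : ℕ) : ℤ) = (2 * ((l / 2 : ℕ) : ℤ) + 1) * 6 := by omega
  have hle := strictMinPow_le_pow_sub hr 2
  rw [hcast] at hle ⊢
  exact hexTop_of_linear_nonneg (p := 7) (ε := 6) (k := 5) (b := 5) (by norm_num) 2 (by norm_num) (by norm_num) hc hle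

/-- **`λ_6` ON ALL PRIMES `l ≥ 11`: in Σ₈ ⟺ `l ≥ 67`** (`RHHeightClassKLine.lambda6_in_sigma8_of_ge_67` / `lambda6_out_sigma8_of_le_61`; no prime in 62..66). [folklore] -/
theorem lambda6_sigma8_iff {l : ℕ} (hl : l.Prime) (h11 : 11 ≤ l) {r : ℤ} (hr : StrictMinPow 7 (l * 5) r) :
    ((((l / 2 : ℕ) : ℤ)) ^ 2 - 1) * ((6 : ℤ) * 5) ≤ ((l / 2 : ℕ) : ℤ) * (((l * 5 : ℕ) : ℤ) - r) + (1 - r) ↔ 67 ≤ l := by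
  constructor
  · intro h
    by_contra hlt
    have hle' : l ≤ 61 := by
      rcases Nat.lt_or_ge l 62 with h1 | h1
      · omega
      · exfalso
        interval_cases l
        all_goals exact absurd hl (by norm_num)
    exact lambda6_out_sigma8_of_le_61 hl h11 hle' r hr h
  · intro hge
    exact (lambda6_in_sigma8_of_ge_67 hl hge).2 r hr

/-- **`λ_7` K-line (`p = 7`, `ε = 30`, `m_q = 210`; CERT-HEX-L0-v1 row `k = 7`: `l₀ = 11`, `e_w = 330`, `r♯ = -647`, `t⋆ = 3`): IN Σ₈ for EVERY prime `l ≥ 11`** — at exponent `t⋆ = 3` the linear part has slope `(2t⋆+2−k)·ε = 30 ≥ 0` and value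
`77 ≥ 0` at `l⋆ = 5`, so the top cell holds at `7^3 − 3·e_w ≥ r♯` for every `l⋆ ≥ 5` (`hexTop_of_linear_nonneg`), hence at the untied `r♯(7, 30l)`. [folklore] -/
theorem lambda7_in_sigma8_of_ge_11 {l : ℕ} (hl : l.Prime) (h11 : 11 ≤ l) :
    (∃ r : ℤ, StrictMinPow 7 (l * 30) r) ∧
      ∀ r : ℤ, StrictMinPow 7 (l * 30) r → ((((l / 2 : ℕ) : ℤ)) ^ 2 - 1) * ((7 : ℤ) * 30) ≤ (((l / 2 : ℕ) : ℤ)) * ((((l * 30 : ℕ) : ℤ)) - (r)) + (1 - (r)) := by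
  have hodd : l % 2 = 1 := Nat.odd_iff.1 (hl.odd_of_ne_two (by omega))
  refine ⟨exists_strictMinPow_kline (p := 7) (by norm_num) hl (by omega) 30, fun r hr => ?_⟩
  have hc : (5 : ℕ) ≤ l / 2 := by omega
  have hcast : ((l * 30 : ℕ) : ℤ) = (2 * ((l / 2 : ℕ) : ℤ) + 1) * 30 := by omega
  have hle := strictMinPow_le_pow_sub hr 3
  rw [hcast] at hle ⊢
  exact hexTop_of_linear_nonneg (p := 7) (ε := 30) (k := 7) (b := 5) (by norm_num) 3 (by norm_num) (by norm_num) hc hle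

/-- `r♯(7, 2235) = -6539`, UNTIED (`l = 149`, `ε = 15`; window `7^3·6 < 2235 < 7^4·6`). [folklore] -/
theorem strictMinPow_7_2235 : StrictMinPow 7 2235 (-6539) := by
  have := strictMinPow_of_window (p := 7) (e := 2235) (t := 3) (by norm_num) (by norm_num) (by norm_num)
  norm_num at this
  exact this

/-- `r♯(7, 2265) = -6659`, UNTIED (`l₀ = 151`, `ε = 15`; window `7^3·6 < 2265 < 7^4·6`) — CERT-HEX-L0-v1 row `k = 8`. [folklore] -/
theorem strictMinPow_7_2265 : StrictMinPow 7 2265 (-6659) := by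
  have := strictMinPow_of_window (p := 7) (e := 2265) (t := 3) (by norm_num) (by norm_num) (by norm_num)
  norm_num at this
  exact this

/-- **`λ_8` NEG rows**: the top cell FAILS at `l = 11` (`e = 165`, `r♯ = -281`: `2880 > 2512`) and at `l = 149` (`l⋆ = 74`, `e = 2235`,
`r♯ = -6539`: `657000 > 655816`). [folklore] -/
theorem lambda8_neg : ¬ ((((5 : ℕ) : ℤ)) ^ 2 - 1) * ((8 : ℤ) * 15) ≤ (((5 : ℕ) : ℤ)) * ((((165 : ℕ) : ℤ)) - ((-281))) + (1 - ((-281))) ∧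
    ¬ ((((74 : ℕ) : ℤ)) ^ 2 - 1) * ((8 : ℤ) * 15) ≤ (((74 : ℕ) : ℤ)) * ((((2235 : ℕ) : ℤ)) - ((-6539))) + (1 - ((-6539))) := by
  constructor <;> norm_num

/-- **`λ_8` POS row**: at `l₀ = 151` (`l⋆ = 75`, `e = 2265`) the top cell HOLDS at the exponent-4 valuation `7^4 − 4·2265 = -6659 = r♯`:
`674880 ≤ 675960`. [folklore] -/
theorem lambda8_pos : ((((75 : ℕ) : ℤ)) ^ 2 - 1) * ((8 : ℤ) * 15) ≤ (((75 : ℕ) : ℤ)) * (((2 * (75 : ℕ) + 1 : ℤ) * 15) - (((7 : ℤ) ^ (4 : ℕ) - ((4 : ℕ) : ℤ) * ((2 * (75 : ℕ) + 1 : ℤ) * 15)))) + (1 - (((7 : ℤ) ^ (4 : ℕ) - ((4 : ℕ) : ℤ) * ((2 * (75 : ℕ) + 1 : ℤ) * 15)))) := by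
  norm_num

/-- **`λ_8` K-line (`p = 7`, `ε = 15`, `m_q = 120`; CERT-HEX-L0-v1 row `k = 8`: `l₀ = 151`, `e_w = 2265`, `r♯ = -6659`, `t⋆ = 4`): IN Σ₈ for EVERY prime `l ≥ 151`** (untied `r♯(7, 15l)` exists since `l > 7`; top cell at it by `hexTop_of_two_rows` from
NEG at `l = 149` and POS at `l₀ = 151`). [folklore] -/
theorem lambda8_in_sigma8_of_ge_151 {l : ℕ} (hl : l.Prime) (hge : 151 ≤ l) :
    (∃ r : ℤ, StrictMinPow 7 (l * 15) r) ∧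
      ∀ r : ℤ, StrictMinPow 7 (l * 15) r → ((((l / 2 : ℕ) : ℤ)) ^ 2 - 1) * ((8 : ℤ) * 15) ≤ (((l / 2 : ℕ) : ℤ)) * ((((l * 15 : ℕ) : ℤ)) - (r)) + (1 - (r)) := by
  have hodd : l % 2 = 1 := Nat.odd_iff.1 (hl.odd_of_ne_two (by omega))
  refine ⟨exists_strictMinPow_kline (p := 7) (by norm_num) hl (by omega) 15, fun r hr => ?_⟩
  have hc : (75 : ℕ) ≤ l / 2 := by omega
  have hcast : ((l * 15 : ℕ) : ℤ) = (2 * ((l / 2 : ℕ) : ℤ) + 1) * 15 := by omega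
  have hle := strictMinPow_le_pow_sub hr 4
  rw [hcast] at hle ⊢
  exact hexTop_of_two_rows (p := 7) (ε := 15) (k := 8) (a := 74) (b := 75) (by norm_num) (by norm_num) (ea := 2235) (by norm_num)
    strictMinPow_7_2235 lambda8_neg.2 4 lambda8_pos hc hle

/-- **`λ_8`: OUT of Σ₈ for every prime `11 ≤ l ≤ 149`** (the top cell FAILS at the untied `r♯`; gap-free side `not_hexTop_between` between the NEG rows
at `l = 11` and `l = 149`). [folklore] -/
theorem lambda8_out_sigma8_of_le_149 {l : ℕ} (hl : l.Prime) (h11 : 11 ≤ l) (hle' : l ≤ 149) :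
    ∀ r : ℤ, StrictMinPow 7 (l * 15) r → ¬ ((((l / 2 : ℕ) : ℤ)) ^ 2 - 1) * ((8 : ℤ) * 15) ≤ (((l / 2 : ℕ) : ℤ)) * ((((l * 15 : ℕ) : ℤ)) - (r)) + (1 - (r)) := by
  intro r hr
  have hodd : l % 2 = 1 := Nat.odd_iff.1 (hl.odd_of_ne_two (by omega))
  have hcast : ((l * 15 : ℕ) : ℤ) = (2 * ((l / 2 : ℕ) : ℤ) + 1) * 15 := by omega
  rcases Nat.lt_or_ge (l / 2) 6 with h5 | h6
  · have hl11 : l = 11 := by omega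
    subst hl11
    have hr' : r = -281 := strictMinPow_unique hr strictMinPow_7_165
    subst hr'
    norm_num
  rcases Nat.lt_or_ge (l / 2) 74 with ha | ha'
  · exact not_hexTop_between (p := 7) (ε := 15) (k := 8) (a := 5) (b := l / 2) (c := 74) (by norm_num) (by omega) (by omega)
      (ea := 165) (eb := l * 15) (ec := 2235) (by norm_num) hcast (by norm_num) strictMinPow_7_165 hr strictMinPow_7_2235
      lambda8_neg.1 lambda8_neg.2
  · have hl' : l = 149 := by omega
    subst hl'
    have hr' : r = -6539 := strictMinPow_unique hr strictMinPow_7_2235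
    subst hr'
    norm_num

/-- **`λ_8` ON ALL PRIMES `l ≥ 11`: in Σ₈ ⟺ `l ≥ 151`** (at the untied `r♯`; no prime lies strictly between `149` and `151`). CERT-HEX-L0-v1 row `k = 8` by name. [folklore] -/
theorem lambda8_sigma8_iff {l : ℕ} (hl : l.Prime) (h11 : 11 ≤ l) {r : ℤ} (hr : StrictMinPow 7 (l * 15) r) :
    ((((l / 2 : ℕ) : ℤ)) ^ 2 - 1) * ((8 : ℤ) * 15) ≤ (((l / 2 : ℕ) : ℤ)) * ((((l * 15 : ℕ) : ℤ)) - (r)) + (1 - (r)) ↔ 151 ≤ l := by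
  constructor
  · intro h
    by_contra hlt
    have hle' : l ≤ 149 := by
      rcases Nat.lt_or_ge l (149 + 1) with h1 | h1
      · omega
      · exfalso
        interval_cases l
        all_goals exact absurd hl (by norm_num)
    exact lambda8_out_sigma8_of_le_149 hl h11 hle' r hr h
  · intro hge
    exact (lambda8_in_sigma8_of_ge_151 hl hge).2 r hr

/-- `r♯(7, 4570) = -15879`, UNTIED (`l = 457`, `ε = 10`; window `7^3·6 < 4570 < 7^4·6`). [folklore] -/
theorem strictMinPow_7_4570 : StrictMinPow 7 4570 (-15879) := by
  have := strictMinPow_of_window (p := 7) (e := 4570) (t := 3) (by norm_num) (by norm_num) (by norm_num)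
  norm_num at this
  exact this

/-- `r♯(7, 4610) = -16039`, UNTIED (`l₀ = 461`, `ε = 10`; window `7^3·6 < 4610 < 7^4·6`) — CERT-HEX-L0-v1 row `k = 9`. [folklore] -/
theorem strictMinPow_7_4610 : StrictMinPow 7 4610 (-16039) := by
  have := strictMinPow_of_window (p := 7) (e := 4610) (t := 3) (by norm_num) (by norm_num) (by norm_num)
  norm_num at this
  exact this

/-- **`λ_9` NEG rows**: the top cell FAILS at `l = 11` (`e = 110`, `r♯ = -171`: `2160 > 1577`) and at `l = 457` (`l⋆ = 228`, `e = 4570`,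
`r♯ = -15879`: `4678470 > 4678252`). [folklore] -/
theorem lambda9_neg : ¬ ((((5 : ℕ) : ℤ)) ^ 2 - 1) * ((9 : ℤ) * 10) ≤ (((5 : ℕ) : ℤ)) * ((((110 : ℕ) : ℤ)) - ((-171))) + (1 - ((-171))) ∧
    ¬ ((((228 : ℕ) : ℤ)) ^ 2 - 1) * ((9 : ℤ) * 10) ≤ (((228 : ℕ) : ℤ)) * ((((4570 : ℕ) : ℤ)) - ((-15879))) + (1 - ((-15879))) := by
  constructor <;> norm_num

/-- **`λ_9` POS row**: at `l₀ = 461` (`l⋆ = 230`, `e = 4610`) the top cell HOLDS at the exponent-4 valuation `7^4 − 4·4610 = -16039 = r♯`: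
`4760910 ≤ 4765310`. [folklore] -/
theorem lambda9_pos : ((((230 : ℕ) : ℤ)) ^ 2 - 1) * ((9 : ℤ) * 10) ≤ (((230 : ℕ) : ℤ)) * (((2 * (230 : ℕ) + 1 : ℤ) * 10) - (((7 : ℤ) ^ (4 : ℕ) - ((4 : ℕ) : ℤ) * ((2 * (230 : ℕ) + 1 : ℤ) * 10)))) + (1 - (((7 : ℤ) ^ (4 : ℕ) - ((4 : ℕ) : ℤ) * ((2 * (230 : ℕ) + 1 : ℤ) * 10)))) := by
  norm_num

/-- **`λ_9` K-line (`p = 7`, `ε = 10`, `m_q = 90`; CERT-HEX-L0-v1 row `k = 9`: `l₀ = 461`, `e_w = 4610`, `r♯ = -16039`, `t⋆ = 4`): IN Σ₈ for EVERY prime `l ≥ 461`** (untied `r♯(7, 10l)` exists since `l > 7`; top cell at it by `hexTop_of_two_rows` from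
NEG at `l = 457` and POS at `l₀ = 461`). [folklore] -/
theorem lambda9_in_sigma8_of_ge_461 {l : ℕ} (hl : l.Prime) (hge : 461 ≤ l) :
    (∃ r : ℤ, StrictMinPow 7 (l * 10) r) ∧
      ∀ r : ℤ, StrictMinPow 7 (l * 10) r → ((((l / 2 : ℕ) : ℤ)) ^ 2 - 1) * ((9 : ℤ) * 10) ≤ (((l / 2 : ℕ) : ℤ)) * ((((l * 10 : ℕ) : ℤ)) - (r)) + (1 - (r)) := by
  have hodd : l % 2 = 1 := Nat.odd_iff.1 (hl.odd_of_ne_two (by omega))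
  refine ⟨exists_strictMinPow_kline (p := 7) (by norm_num) hl (by omega) 10, fun r hr => ?_⟩
  have hc : (230 : ℕ) ≤ l / 2 := by omega
  have hcast : ((l * 10 : ℕ) : ℤ) = (2 * ((l / 2 : ℕ) : ℤ) + 1) * 10 := by omega
  have hle := strictMinPow_le_pow_sub hr 4
  rw [hcast] at hle ⊢
  exact hexTop_of_two_rows (p := 7) (ε := 10) (k := 9) (a := 228) (b := 230) (by norm_num) (by norm_num) (ea := 4570) (by norm_num)
    strictMinPow_7_4570 lambda9_neg.2 4 lambda9_pos hc hle

/-- **`λ_9`: OUT of Σ₈ for every prime `11 ≤ l ≤ 457`** (the top cell FAILS at the untied `r♯`; gap-free side `not_hexTop_between` between the NEG rows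
at `l = 11` and `l = 457`). [folklore] -/
theorem lambda9_out_sigma8_of_le_457 {l : ℕ} (hl : l.Prime) (h11 : 11 ≤ l) (hle' : l ≤ 457) :
    ∀ r : ℤ, StrictMinPow 7 (l * 10) r → ¬ ((((l / 2 : ℕ) : ℤ)) ^ 2 - 1) * ((9 : ℤ) * 10) ≤ (((l / 2 : ℕ) : ℤ)) * ((((l * 10 : ℕ) : ℤ)) - (r)) + (1 - (r)) := by
  intro r hr
  have hodd : l % 2 = 1 := Nat.odd_iff.1 (hl.odd_of_ne_two (by omega))
  have hcast : ((l * 10 : ℕ) : ℤ) = (2 * ((l / 2 : ℕ) : ℤ) + 1) * 10 := by omega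
  rcases Nat.lt_or_ge (l / 2) 6 with h5 | h6
  · have hl11 : l = 11 := by omega
    subst hl11
    have hr' : r = -171 := strictMinPow_unique hr strictMinPow_7_110
    subst hr'
    norm_num
  rcases Nat.lt_or_ge (l / 2) 228 with ha | ha'
  · exact not_hexTop_between (p := 7) (ε := 10) (k := 9) (a := 5) (b := l / 2) (c := 228) (by norm_num) (by omega) (by omega)
      (ea := 110) (eb := l * 10) (ec := 4570) (by norm_num) hcast (by norm_num) strictMinPow_7_110 hr strictMinPow_7_4570
      lambda9_neg.1 lambda9_neg.2
  · have hl' : l = 457 := by omega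
    subst hl'
    have hr' : r = -15879 := strictMinPow_unique hr strictMinPow_7_4570
    subst hr'
    norm_num

/-- **`λ_9` ON ALL PRIMES `l ≥ 11`: in Σ₈ ⟺ `l ≥ 461`** (at the untied `r♯`; no prime lies strictly between `457` and `461`). CERT-HEX-L0-v1 row `k = 9` by name. [folklore] -/
theorem lambda9_sigma8_iff {l : ℕ} (hl : l.Prime) (h11 : 11 ≤ l) {r : ℤ} (hr : StrictMinPow 7 (l * 10) r) :
    ((((l / 2 : ℕ) : ℤ)) ^ 2 - 1) * ((9 : ℤ) * 10) ≤ (((l / 2 : ℕ) : ℤ)) * ((((l * 10 : ℕ) : ℤ)) - (r)) + (1 - (r)) ↔ 461 ≤ l := by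
  constructor
  · intro h
    by_contra hlt
    have hle' : l ≤ 457 := by
      rcases Nat.lt_or_ge l (457 + 1) with h1 | h1
      · omega
      · exfalso
        interval_cases l
        all_goals exact absurd hl (by norm_num)
    exact lambda9_out_sigma8_of_le_457 hl h11 hle' r hr h
  · intro hge
    exact (lambda9_in_sigma8_of_ge_461 hl hge).2 r hr

/-- `r♯(7, 16743) = -66908`, UNTIED (`l = 5581`, `ε = 3`; window `7^4·6 < 16743 < 7^5·6`). [folklore] -/
theorem strictMinPow_7_16743 : StrictMinPow 7 16743 (-66908) := by
  have := strictMinPow_of_window (p := 7) (e := 16743) (t := 4) (by norm_num) (by norm_num) (by norm_num)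
  norm_num at this
  exact this

/-- `r♯(7, 16773) = -67058`, UNTIED (`l₀ = 5591`, `ε = 3`; window `7^4·6 < 16773 < 7^5·6`) — CERT-HEX-L0-v1 row `k = 10`. [folklore] -/
theorem strictMinPow_7_16773 : StrictMinPow 7 16773 (-67058) := by
  have := strictMinPow_of_window (p := 7) (e := 16773) (t := 4) (by norm_num) (by norm_num) (by norm_num)
  norm_num at this
  exact this

/-- **`λ_10` NEG rows**: the top cell FAILS at `l = 11` (`e = 33`, `r♯ = -26`: `720 > 322`) and at `l = 5581` (`l⋆ = 2790`, `e = 16743`,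
`r♯ = -66908`: `233522970 > 233453199`). [folklore] -/
theorem lambda10_neg : ¬ ((((5 : ℕ) : ℤ)) ^ 2 - 1) * ((10 : ℤ) * 3) ≤ (((5 : ℕ) : ℤ)) * ((((33 : ℕ) : ℤ)) - ((-26))) + (1 - ((-26))) ∧
    ¬ ((((2790 : ℕ) : ℤ)) ^ 2 - 1) * ((10 : ℤ) * 3) ≤ (((2790 : ℕ) : ℤ)) * ((((16743 : ℕ) : ℤ)) - ((-66908))) + (1 - ((-66908))) := by
  constructor <;> norm_num

/-- **`λ_10` POS row**: at `l₀ = 5591` (`l⋆ = 2795`, `e = 16773`) the top cell HOLDS at the exponent-5 valuation `7^5 − 5·16773 = -67058 = r♯`: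
`234360720 ≤ 234374704`. [folklore] -/
theorem lambda10_pos : ((((2795 : ℕ) : ℤ)) ^ 2 - 1) * ((10 : ℤ) * 3) ≤ (((2795 : ℕ) : ℤ)) * (((2 * (2795 : ℕ) + 1 : ℤ) * 3) - (((7 : ℤ) ^ (5 : ℕ) - ((5 : ℕ) : ℤ) * ((2 * (2795 : ℕ) + 1 : ℤ) * 3)))) + (1 - (((7 : ℤ) ^ (5 : ℕ) - ((5 : ℕ) : ℤ) * ((2 * (2795 : ℕ) + 1 : ℤ) * 3)))) := by
  norm_num

/-- **`λ_10` K-line (`p = 7`, `ε = 3`, `m_q = 30`; CERT-HEX-L0-v1 row `k = 10`: `l₀ = 5591`, `e_w = 16773`, `r♯ = -67058`, `t⋆ = 5`): IN Σ₈ for EVERY prime `l ≥ 5591`** (untied `r♯(7, 3l)` exists since `l > 7`; top cell at it by `hexTop_of_two_rows` from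
NEG at `l = 5581` and POS at `l₀ = 5591`). [folklore] -/
theorem lambda10_in_sigma8_of_ge_5591 {l : ℕ} (hl : l.Prime) (hge : 5591 ≤ l) :
    (∃ r : ℤ, StrictMinPow 7 (l * 3) r) ∧
      ∀ r : ℤ, StrictMinPow 7 (l * 3) r → ((((l / 2 : ℕ) : ℤ)) ^ 2 - 1) * ((10 : ℤ) * 3) ≤ (((l / 2 : ℕ) : ℤ)) * ((((l * 3 : ℕ) : ℤ)) - (r)) + (1 - (r)) := by
  have hodd : l % 2 = 1 := Nat.odd_iff.1 (hl.odd_of_ne_two (by omega))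
  refine ⟨exists_strictMinPow_kline (p := 7) (by norm_num) hl (by omega) 3, fun r hr => ?_⟩
  have hc : (2795 : ℕ) ≤ l / 2 := by omega
  have hcast : ((l * 3 : ℕ) : ℤ) = (2 * ((l / 2 : ℕ) : ℤ) + 1) * 3 := by omega
  have hle := strictMinPow_le_pow_sub hr 5
  rw [hcast] at hle ⊢
  exact hexTop_of_two_rows (p := 7) (ε := 3) (k := 10) (a := 2790) (b := 2795) (by norm_num) (by norm_num) (ea := 16743) (by norm_num)
    strictMinPow_7_16743 lambda10_neg.2 5 lambda10_pos hc hle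

/-- **`λ_10`: OUT of Σ₈ for every prime `11 ≤ l ≤ 5581`** (the top cell FAILS at the untied `r♯`; gap-free side `not_hexTop_between` between the NEG rows
at `l = 11` and `l = 5581`). [folklore] -/
theorem lambda10_out_sigma8_of_le_5581 {l : ℕ} (hl : l.Prime) (h11 : 11 ≤ l) (hle' : l ≤ 5581) :
    ∀ r : ℤ, StrictMinPow 7 (l * 3) r → ¬ ((((l / 2 : ℕ) : ℤ)) ^ 2 - 1) * ((10 : ℤ) * 3) ≤ (((l / 2 : ℕ) : ℤ)) * ((((l * 3 : ℕ) : ℤ)) - (r)) + (1 - (r)) := by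
  intro r hr
  have hodd : l % 2 = 1 := Nat.odd_iff.1 (hl.odd_of_ne_two (by omega))
  have hcast : ((l * 3 : ℕ) : ℤ) = (2 * ((l / 2 : ℕ) : ℤ) + 1) * 3 := by omega
  rcases Nat.lt_or_ge (l / 2) 6 with h5 | h6
  · have hl11 : l = 11 := by omega
    subst hl11
    have hr' : r = -26 := strictMinPow_unique hr strictMinPow_7_33
    subst hr'
    norm_num
  rcases Nat.lt_or_ge (l / 2) 2790 with ha | ha'
  · exact not_hexTop_between (p := 7) (ε := 3) (k := 10) (a := 5) (b := l / 2) (c := 2790) (by norm_num) (by omega) (by omega)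
      (ea := 33) (eb := l * 3) (ec := 16743) (by norm_num) hcast (by norm_num) strictMinPow_7_33 hr strictMinPow_7_16743
      lambda10_neg.1 lambda10_neg.2
  · have hl' : l = 5581 := by omega
    subst hl'
    have hr' : r = -66908 := strictMinPow_unique hr strictMinPow_7_16743
    subst hr'
    norm_num

/-- **`λ_10` ON ALL PRIMES `l ≥ 11`: in Σ₈ ⟺ `l ≥ 5591`** (at the untied `r♯`; no prime lies strictly between `5581` and `5591`). CERT-HEX-L0-v1 row `k = 10` by name. [folklore] -/
theorem lambda10_sigma8_iff {l : ℕ} (hl : l.Prime) (h11 : 11 ≤ l) {r : ℤ} (hr : StrictMinPow 7 (l * 3) r) :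
    ((((l / 2 : ℕ) : ℤ)) ^ 2 - 1) * ((10 : ℤ) * 3) ≤ (((l / 2 : ℕ) : ℤ)) * ((((l * 3 : ℕ) : ℤ)) - (r)) + (1 - (r)) ↔ 5591 ≤ l := by
  constructor
  · intro h
    by_contra hlt
    have hle' : l ≤ 5581 := by
      rcases Nat.lt_or_ge l (5581 + 1) with h1 | h1
      · omega
      · exfalso
        interval_cases l
        all_goals exact absurd hl (by norm_num)
    exact lambda10_out_sigma8_of_le_5581 hl h11 hle' r hr h
  · intro hge
    exact (lambda10_in_sigma8_of_ge_5591 hl hge).2 r hr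

end Summit.ABC.IUTFork.Repair.RHHeightClass.KLine
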